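import Mathlib
import HarnessLib

/-!
# Line `equipartition_seam` (crux `IRcof`, stmt-QuantumFields-26930): stub S4ᵛ in FLUX–FOURIER form (adapter)

WHAT THIS FILE PROVES (abstract, finite Fourier analysis on a finite abelian group `α` = the electric twist group
`(ker π)^{3}`; no measure theory): let `Z W : α → ℝ` be the sector weights `Z(x) = μ̃_β(E_{(x,m)})` and the
sector integrals `W(x) = ∫_{E_{(x,m)}} Ã dμ̃_β` of ONE species at fixed magnetic part `m`.  If

* (EQUI, = stub S3 in sector form) `|Z(x) − Z(0)| ≤ δ·Z(0)` for all `x`, with `0 ≤ Z(0)`, `0 ≤ δ ≤ 1/2`, and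
* (FLUX DOMINATION, the located input) for every character `ψ` of `α` (= every ELECTRIC FLUX `e`):
  `‖Σ_x ψ(x) W(x)‖ ≤ K · Re Σ_x ψ(x) Z(x)` — "the flux-`e` projection of the slab state is a functional of norm
  `≤ K = K_A` relative to the flux-`e` partition function `Ẑ(e) ≥ 0`" (Osterwalder–Seiler reflection positivity +
  't Hooft's electric-flux projections; Borgs–Seiler 1983 construct exactly these objects),

then unit blindness holds in the PAIR FORM that `EBlindUnitOn` (p676630) asks for:
`|W(x)·Z(y) − W(y)·Z(x)| ≤ 44·K·δ·Z(x)·Z(y)` for all `x, y` — constant `44 K`, RATE = EQUI's `δ`, and NO dependence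
on `|α|`.  Proof: Fourier inversion `|α|·W(x) = Σ_ψ Ŵ(ψ)·conj ψ(x)`; the `ψ ≠ 0` part has norm
`≤ K·Σ_{ψ≠0} Re Ẑ(ψ) = K·(|α| Z(0) − Σ_u Z(u)) ≤ K|α|δ Z(0)`; so `W` and `Z` are `O(Kδ Z(0))`- resp. `O(δ Z(0))`-close
to their means, and the antisymmetric combination telescopes.

WHY (scoping of the seam S4ᵛ `EBlindUnitsV`, for the successor): this replaces the matrix-level engine
(`centreFourier_traceBlindness_opNorm`, p666431; pair form `Lines/equipartition_seam_EnginePair.lean`) by the two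
MEASURE-FACING inputs the seam really needs — EQUI (S3) and FLUX DOMINATION — with all operator theory gone.  What
remains LOCATED and wall-adjacent for S4ᵛ is precisely: (F) flux domination for the SPLIT-WEIGHT sectors
(`TwistSplitWeight`, S1) via a reflection-positive transfer operator with centre-twist operators on the H-torus
(Osterwalder–Seiler 1978; Borgs–Seiler, Commun. Math. Phys. 91 (1983) 329), and (N) the split-noise ∕ threshold
bookkeeping `sharp sectors ↔ split sectors` (`e^{−c(β)β}` per plaquette, thresholds `S_b(β)`).  CLASS: adapter ∕
bookkeeping (finite Fourier analysis) — NOT a located lemma; no wall of census row 47 is touched.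

HONEST LABEL: the Yang–Mills mass gap (Clay) is NOT proved; `IRcof` ∕ `IR` 0 ∕ 1; row 47 class PWP unchanged
(walls S3 ∕ S5ᵛ untouched); mechanism 0; nothing continuum ∕ OS ∕ Clay.  Ideator `ym-ir-idea-22` g5, 2026-08-29.
-/

set_option autoImplicit false

open scoped ComplexConjugate BigOperators
open Finset

namespace Summit.QuantumFields.YangMills.Cruxes.IRcof.EquipartitionSeam.FluxFourier

variable {α : Type} [AddCommGroup α] [Fintype α] [DecidableEq α]

/-- Fourier coefficient of `f : α → ℂ` at the character `ψ`: `f̂(ψ) = Σ_x ψ(x)·f(x)`. -/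
def coeff (ψ : AddChar α ℂ) (f : α → ℂ) : ℂ := ∑ x, ψ x * f x

omit [DecidableEq α] in
theorem coeff_zero (f : α → ℂ) : coeff (0 : AddChar α ℂ) f = ∑ x, f x := by
  simp [coeff]

/-- **Fourier inversion at a point**: `Σ_ψ f̂(ψ)·conj ψ(x) = |α|·f(x)`. -/
theorem sum_coeff_mul_conj (f : α → ℂ) (x : α) :
    ∑ ψ : AddChar α ℂ, coeff ψ f * conj (ψ x) = (Fintype.card α : ℂ) * f x := by
  have h1 : ∀ ψ : AddChar α ℂ, coeff ψ f * conj (ψ x) = ∑ u, f u * ψ (u - x) := by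
    intro ψ
    unfold coeff
    rw [Finset.sum_mul]
    refine Finset.sum_congr rfl fun u _ => ?_
    rw [sub_eq_add_neg, AddChar.map_add_eq_mul, AddChar.map_neg_eq_conj]
    ring
  simp_rw [h1]
  rw [Finset.sum_comm]
  simp_rw [← Finset.mul_sum, AddChar.sum_apply_eq_ite, sub_eq_zero, mul_ite, mul_zero]
  rw [Finset.sum_ite_eq' Finset.univ x]
  simp [mul_comm]

/-- Fourier inversion with the trivial character split off:
`|α|·f(x) − Σ_u f(u) = Σ_{ψ ≠ 0} f̂(ψ)·conj ψ(x)`. -/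
theorem card_mul_sub_sum_eq (f : α → ℂ) (x : α) :
    (Fintype.card α : ℂ) * f x - ∑ u, f u =
      ∑ ψ ∈ (Finset.univ : Finset (AddChar α ℂ)).erase 0, coeff ψ f * conj (ψ x) := by
  rw [← sum_coeff_mul_conj f x, ← coeff_zero f,
    ← Finset.add_sum_erase (Finset.univ : Finset (AddChar α ℂ)) _ (Finset.mem_univ (0 : AddChar α ℂ))]
  simp

/-- **EBLIND from EQUI + flux domination (pair form, rate = EQUI's, constant `44·K`).** -/
theorem eblind_of_fluxDomination (Z W : α → ℝ) (K δ : ℝ) (hK : 0 ≤ K) (hδ : 0 ≤ δ) (hδ1 : δ ≤ 1 / 2)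
    (hZ : 0 ≤ Z 0)
    (hdom : ∀ ψ : AddChar α ℂ, ‖∑ x, ψ x * (W x : ℂ)‖ ≤ K * (∑ x, ψ x * (Z x : ℂ)).re)
    (hequi : ∀ x : α, |Z x - Z 0| ≤ δ * Z 0) (x y : α) :
    |W x * Z y - W y * Z x| ≤ 44 * K * δ * (Z x * Z y) := by
  -- the complexified data
  set Zc : α → ℂ := fun u => (Z u : ℂ) with hZc
  set Wc : α → ℂ := fun u => (W u : ℂ) with hWc
  have hN : 0 < (Fintype.card α : ℝ) := by exact_mod_cast Fintype.card_pos
  set N : ℝ := (Fintype.card α : ℝ) with hNdef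
  set Z0 : ℝ := Z 0 with hZ0
  -- means
  set zbar : ℝ := (∑ u, Z u) / N with hzbar
  set wbar : ℝ := (∑ u, W u) / N with hwbar
  -- (1) `Σ_u (Z0 − Z u) ≤ N δ Z0` and `|Σ_u (Z u − Z0)| ≤ N δ Z0`
  have hdev : |∑ u, (Z u - Z0)| ≤ N * (δ * Z0) := by
    calc |∑ u, (Z u - Z0)| ≤ ∑ u, |Z u - Z0| := Finset.abs_sum_le_sum_abs _ _
      _ ≤ ∑ _u : α, δ * Z0 := Finset.sum_le_sum fun u _ => hequi u
      _ = N * (δ * Z0) := by simp [hNdef]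
  -- (2) `|Z u − zbar| ≤ 2 δ Z0`
  have hzbar0 : |Z0 - zbar| ≤ δ * Z0 := by
    have h1 : Z0 - zbar = -(∑ u, (Z u - Z0)) / N := by
      rw [hzbar, Finset.sum_sub_distrib]
      field_simp
      simp [hNdef]
      ring
    rw [h1, abs_div, abs_neg, abs_of_pos hN, div_le_iff₀ hN]
    calc |∑ u, (Z u - Z0)| ≤ N * (δ * Z0) := hdev
      _ = δ * Z0 * N := by ring
  have hf : ∀ u : α, |Z u - zbar| ≤ 2 * (δ * Z0) := by
    intro u
    calc |Z u - zbar| = |(Z u - Z0) + (Z0 - zbar)| := by ring_nf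
      _ ≤ |Z u - Z0| + |Z0 - zbar| := abs_add_le _ _
      _ ≤ δ * Z0 + δ * Z0 := add_le_add (hequi u) hzbar0
      _ = 2 * (δ * Z0) := by ring
  -- (3) `|W u − wbar| ≤ K δ Z0` (Fourier inversion + flux domination)
  have hcoeffZ_sum : (∑ ψ : AddChar α ℂ, coeff ψ Zc).re = N * Z0 := by
    have h := sum_coeff_mul_conj Zc 0
    simp only [AddChar.map_zero_eq_one, map_one, mul_one] at h
    rw [h]
    simp [hZc, hNdef, hZ0]
  have hcoeffZ_zero : (coeff (0 : AddChar α ℂ) Zc).re = ∑ u, Z u := by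
    rw [coeff_zero]
    simp [hZc]
  have htail : ∑ ψ ∈ (Finset.univ : Finset (AddChar α ℂ)).erase 0, ‖coeff ψ Wc‖ ≤ K * (N * (δ * Z0)) := by
    calc ∑ ψ ∈ (Finset.univ : Finset (AddChar α ℂ)).erase 0, ‖coeff ψ Wc‖
        ≤ ∑ ψ ∈ (Finset.univ : Finset (AddChar α ℂ)).erase 0, K * (coeff ψ Zc).re :=
          Finset.sum_le_sum fun ψ _ => hdom ψ
      _ = K * ((∑ ψ : AddChar α ℂ, coeff ψ Zc).re - (coeff (0 : AddChar α ℂ) Zc).re) := by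
          rw [← Finset.mul_sum, ← Complex.re_sum, ← Complex.sub_re,
            ← Finset.add_sum_erase Finset.univ _ (Finset.mem_univ (0 : AddChar α ℂ))]
          simp
      _ = K * (∑ u, (Z0 - Z u)) := by
          rw [hcoeffZ_sum, hcoeffZ_zero, Finset.sum_sub_distrib]
          simp [hNdef]
      _ ≤ K * (N * (δ * Z0)) := by
          refine mul_le_mul_of_nonneg_left ?_ hK
          have : ∑ u, (Z0 - Z u) = -(∑ u, (Z u - Z0)) := by
            rw [← Finset.sum_neg_distrib]; simp
          rw [this]
          exact (neg_le_abs _).trans hdev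
  have he : ∀ u : α, |W u - wbar| ≤ K * (δ * Z0) := by
    intro u
    have hkey := card_mul_sub_sum_eq Wc u
    -- real parts: `N W u − Σ W = Re (Σ_{ψ≠0} …)`
    have hre : N * W u - ∑ v, W v =
        (∑ ψ ∈ (Finset.univ : Finset (AddChar α ℂ)).erase 0, coeff ψ Wc * conj (ψ u)).re := by
      rw [← hkey]
      simp [hWc, hNdef]
    have hnorm : |N * W u - ∑ v, W v| ≤ K * (N * (δ * Z0)) := by
      rw [hre]
      calc |(∑ ψ ∈ (Finset.univ : Finset (AddChar α ℂ)).erase 0, coeff ψ Wc * conj (ψ u)).re|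
          ≤ ‖∑ ψ ∈ (Finset.univ : Finset (AddChar α ℂ)).erase 0, coeff ψ Wc * conj (ψ u)‖ :=
            Complex.abs_re_le_norm _
        _ ≤ ∑ ψ ∈ (Finset.univ : Finset (AddChar α ℂ)).erase 0, ‖coeff ψ Wc * conj (ψ u)‖ :=
            norm_sum_le _ _
        _ = ∑ ψ ∈ (Finset.univ : Finset (AddChar α ℂ)).erase 0, ‖coeff ψ Wc‖ := by
            refine Finset.sum_congr rfl fun ψ _ => ?_
            rw [norm_mul, Complex.norm_conj, AddChar.norm_apply, mul_one]
        _ ≤ K * (N * (δ * Z0)) := htail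
    have h1 : W u - wbar = (N * W u - ∑ v, W v) / N := by
      rw [hwbar]; field_simp
    rw [h1, abs_div, abs_of_pos hN, div_le_iff₀ hN]
    calc |N * W u - ∑ v, W v| ≤ K * (N * (δ * Z0)) := hnorm
      _ = K * (δ * Z0) * N := by ring
  -- (4) `|wbar| ≤ K zbar`, `zbar ≤ (1 + δ) Z0`
  have hwz : |wbar| ≤ K * zbar := by
    have h := hdom 0
    simp only [AddChar.zero_apply, one_mul] at h
    rw [← Complex.ofReal_sum, ← Complex.ofReal_sum, Complex.norm_real, Complex.ofReal_re,
      Real.norm_eq_abs] at h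
    rw [hwbar, hzbar, abs_div, abs_of_pos hN, div_le_iff₀ hN]
    calc |∑ u, W u| ≤ K * ∑ u, Z u := h
      _ = K * ((∑ u, Z u) / N) * N := by field_simp
  have hzb : zbar ≤ (1 + δ) * Z0 := by
    have h1 : zbar - Z0 ≤ δ * Z0 := by
      have := hzbar0; rw [abs_sub_comm] at this; exact (le_abs_self _).trans this
    linarith
  have hzb0 : 0 ≤ zbar := by
    have h1 : Z0 - zbar ≤ δ * Z0 := (le_abs_self _).trans hzbar0
    nlinarith
  -- (5) lower bounds `Z u ≥ (1 − δ) Z0 ≥ Z0 / 2`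
  have hlow : ∀ u : α, Z0 / 2 ≤ Z u := by
    intro u
    have h1 : Z0 - Z u ≤ δ * Z0 := by
      have := hequi u; rw [abs_sub_comm] at this; exact (le_abs_self _).trans this
    nlinarith
  -- (6) the telescoping identity and the final estimate
  have hid : W x * Z y - W y * Z x =
      wbar * ((Z y - zbar) - (Z x - zbar)) + zbar * ((W x - wbar) - (W y - wbar)) +
        ((W x - wbar) * (Z y - zbar) - (W y - wbar) * (Z x - zbar)) := by ring
  have hex := he x
  have hey := he y
  have hfx := hf x
  have hfy := hf y
  have hKδZ : 0 ≤ K * (δ * Z0) := by positivity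
  have hδZ : 0 ≤ δ * Z0 := by positivity
  have hT1 : |wbar * ((Z y - zbar) - (Z x - zbar))| ≤ K * ((1 + δ) * Z0) * (4 * (δ * Z0)) := by
    rw [abs_mul]
    refine mul_le_mul (hwz.trans (mul_le_mul_of_nonneg_left hzb hK)) ?_ (abs_nonneg _) (by positivity)
    calc |(Z y - zbar) - (Z x - zbar)| ≤ |Z y - zbar| + |Z x - zbar| := abs_sub _ _
      _ ≤ 2 * (δ * Z0) + 2 * (δ * Z0) := add_le_add hfy hfx
      _ = 4 * (δ * Z0) := by ring
  have hT2 : |zbar * ((W x - wbar) - (W y - wbar))| ≤ ((1 + δ) * Z0) * (2 * (K * (δ * Z0))) := by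
    rw [abs_mul, abs_of_nonneg hzb0]
    refine mul_le_mul hzb ?_ (abs_nonneg _) (by positivity)
    calc |(W x - wbar) - (W y - wbar)| ≤ |W x - wbar| + |W y - wbar| := abs_sub _ _
      _ ≤ K * (δ * Z0) + K * (δ * Z0) := add_le_add hex hey
      _ = 2 * (K * (δ * Z0)) := by ring
  have hT3 : |(W x - wbar) * (Z y - zbar) - (W y - wbar) * (Z x - zbar)| ≤
      2 * ((K * (δ * Z0)) * (2 * (δ * Z0))) := by
    calc |(W x - wbar) * (Z y - zbar) - (W y - wbar) * (Z x - zbar)|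
        ≤ |(W x - wbar) * (Z y - zbar)| + |(W y - wbar) * (Z x - zbar)| := abs_sub _ _
      _ = |W x - wbar| * |Z y - zbar| + |W y - wbar| * |Z x - zbar| := by rw [abs_mul, abs_mul]
      _ ≤ (K * (δ * Z0)) * (2 * (δ * Z0)) + (K * (δ * Z0)) * (2 * (δ * Z0)) :=
          add_le_add (mul_le_mul hex hfy (abs_nonneg _) hKδZ) (mul_le_mul hey hfx (abs_nonneg _) hKδZ)
      _ = 2 * ((K * (δ * Z0)) * (2 * (δ * Z0))) := by ring
  have hsum : |W x * Z y - W y * Z x| ≤ 11 * K * δ * Z0 ^ 2 := by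
    rw [hid]
    calc |wbar * ((Z y - zbar) - (Z x - zbar)) + zbar * ((W x - wbar) - (W y - wbar)) +
            ((W x - wbar) * (Z y - zbar) - (W y - wbar) * (Z x - zbar))|
        ≤ |wbar * ((Z y - zbar) - (Z x - zbar))| + |zbar * ((W x - wbar) - (W y - wbar))| +
            |(W x - wbar) * (Z y - zbar) - (W y - wbar) * (Z x - zbar)| :=
          (abs_add_le _ _).trans (add_le_add (abs_add_le _ _) le_rfl)
      _ ≤ K * ((1 + δ) * Z0) * (4 * (δ * Z0)) + ((1 + δ) * Z0) * (2 * (K * (δ * Z0))) +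
            2 * ((K * (δ * Z0)) * (2 * (δ * Z0))) := add_le_add (add_le_add hT1 hT2) hT3
      _ = (6 * (1 + δ) + 4 * δ) * (K * δ * Z0 ^ 2) := by ring
      _ ≤ 11 * (K * δ * Z0 ^ 2) := by
          have h0 : 0 ≤ K * δ * Z0 ^ 2 := by positivity
          nlinarith
      _ = 11 * K * δ * Z0 ^ 2 := by ring
  -- `Z0² ≤ 4 Z x Z y`
  have hsq : Z0 ^ 2 ≤ 4 * (Z x * Z y) := by
    have hx0 : 0 ≤ Z0 / 2 := by positivity
    have h := mul_le_mul (hlow x) (hlow y) hx0 (hx0.trans (hlow x))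
    nlinarith
  calc |W x * Z y - W y * Z x| ≤ 11 * K * δ * Z0 ^ 2 := hsum
    _ ≤ 11 * K * δ * (4 * (Z x * Z y)) := by
        have : 0 ≤ 11 * K * δ := by positivity
        exact mul_le_mul_of_nonneg_left hsq this
    _ = 44 * K * δ * (Z x * Z y) := by ring

end Summit.QuantumFields.YangMills.Cruxes.IRcof.EquipartitionSeam.FluxFourier
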